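import Literature.MathematicalPhysics.QuantumFieldTheory.LatticeGaugeProofs
import Literature.MathematicalPhysics.QuantumLattice.LatticeGaugeDLRProofs
import HarnessLib

/-!
# Quasi-invariance of the torus Wilson measure under two-sided translations of the links

Family `constructive-qft`, sibling of `TorusWilsonGibbs.lean` / `LatticeGaugeDLRProofs.lean`
(Wilson's lattice gauge theory on the discrete torus `(ℤ/L)^d`,
`Literature.MathematicalPhysics.QuantumFieldTheory.wilsonMeasure`). All declarations are theorems;
no statement or definition is introduced.

* `integral_comp_le_of_map_le_smul` — if `μ ∘ T⁻¹ ≤ c μ` for a measurable equivalence `T`, then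
  `∫ ψ ∘ T dμ ≤ c ∫ ψ dμ` for every nonnegative integrable `ψ` (abstract);
* `abs_wilsonAction_sub_wilsonAction_le` — two configurations that agree off a finite set `A`
  of links have Wilson actions differing by at most `2 (d+1) #{planes} (N + M) · |A|`
  (`M` a bound for `|Re tr ρ|`), uniformly in the side `L` of the torus: only the plaquettes
  based in the shadow of `A` (`edgeShadow`, `bulkAction_congr`, `abs_shadowAction_le`) differ;
* `card_filter_incident_le` — a site of the torus has at most `2d` incident links;
* `exists_measurableEquiv_edgeTranslate` — the edgewise two-sided translations
  `U ↦ (e ↦ a e · U e · (c e)⁻¹)` are measurable equivalences of the configuration space `G^E`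
  preserving the product Haar probability measure (compact groups are unimodular,
  `measurePreserving_mul_mul_inv_haarProbability`);
* `map_wilsonMeasure_le_smul` — **density bound**: a measurable equivalence of `G^E` that
  preserves `Haar^{⊗E}` and moves the Wilson action by at most `K` pushes the Wilson measure
  `μ_{Λ,β} = Z⁻¹ e^{-β S_W} Haar^{⊗E}` forward to at most `e^{|β| K} μ_{Λ,β}`;
* `integral_comp_edgeTranslate_wilsonMeasure_le` — consequently, translating the links of `A`
  costs at most the factor `exp (|β| · 2(d+1) #{planes} (N+M) · |A|)` on nonnegative integrands,
  uniformly in the volume (the quasi-invariance of the finite-volume Gibbs state under local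
  changes of the a priori measure that underlies every DLR / heat-bath comparison argument).

## Sources

* E. Seiler, *Gauge Theories as a Problem of Constructive Quantum Field Theory and Statistical
  Mechanics*, LNP 159 (Springer 1982), Ch. 1–2: the a priori measure of lattice gauge theory is
  the bi-invariant Haar measure and the Wilson action is a sum of bounded plaquette terms, each
  reading four links — whence the finite-volume state changes by a volume-independent factor
  under a bounded local change of finitely many link variables. Standard; recorded as folklore.
* S. Chatterjee, *Yang–Mills for probabilists*, arXiv:1803.01950, §2–§3 (the torus Wilson
  measure as a density against product Haar measure).
-/

noncomputable section

open MeasureTheory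
open Literature.MathematicalPhysics.QuantumFieldTheory (Site Edge Plaquette GaugeConfig
  Site.shift haarProbability wilsonAction wilsonWeight partitionFunction wilsonMeasure edgeShadow
  shadowAction bulkAction card_edgeShadow_le wilsonAction_eq_shadowAction_add_bulkAction
  abs_shadowAction_le bulkAction_congr)

namespace Literature.MathematicalPhysics.QuantumLattice

/-! ### A density bound turns into an integral bound -/

/-- If the push-forward of `μ` under a measurable equivalence `T` is at most `c μ`, then
`∫ ψ ∘ T dμ ≤ c ∫ ψ dμ` for every nonnegative `μ`-integrable `ψ` (change of variables along `T`,
monotonicity of the integral in the measure). [folklore] -/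
theorem integral_comp_le_of_map_le_smul {Ω : Type*} [MeasurableSpace Ω] {μ : Measure Ω} {c : ℝ}
    (hc : 0 ≤ c) (T : Ω ≃ᵐ Ω) (hle : μ.map T ≤ ENNReal.ofReal c • μ) {ψ : Ω → ℝ}
    (hψ0 : ∀ ω, 0 ≤ ψ ω) (hψi : Integrable ψ μ) : ∫ ω, ψ (T ω) ∂μ ≤ c * ∫ ω, ψ ω ∂μ := by
  rw [← integral_map_equiv]
  calc ∫ ω, ψ ω ∂(μ.map T) ≤ ∫ ω, ψ ω ∂(ENNReal.ofReal c • μ) :=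
        integral_mono_measure hle (ae_of_all _ hψ0) (hψi.smul_measure ENNReal.ofReal_ne_top)
    _ = c * ∫ ω, ψ ω ∂μ := by
        rw [integral_smul_measure, ENNReal.toReal_ofReal hc, smul_eq_mul]

/-! ### The torus: local changes of the Wilson action, incident links -/

section Torus

variable {d L N : ℕ} {G : Type*} [Group G] [NeZero L]

/-- **Local changes move the Wilson action by a volume-independent amount**: if `V` and `W`
agree off a finite set `A` of links and `|Re tr ρ| ≤ M`, then
`|S_W(V) - S_W(W)| ≤ 2 (d+1) #{planes} (N + M) · |A|` — the plaquettes based outside the shadow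
of `A` contribute equally (`bulkAction_congr`), and the shadow part of each action is bounded by
`abs_shadowAction_le` with `|edgeShadow A| ≤ (d+1)|A|`. [folklore] -/
theorem abs_wilsonAction_sub_wilsonAction_le (ρ : G →* Matrix (Fin N) (Fin N) ℂ) {M : ℝ}
    (hM : ∀ g, |(ρ g).trace.re| ≤ M) (A : Finset (Edge d L)) (V W : GaugeConfig d L G)
    (hVW : ∀ e ∉ A, V e = W e) :
    |wilsonAction ρ V - wilsonAction ρ W| ≤
      2 * (((d + 1) * Fintype.card {q : Fin d × Fin d // q.1 < q.2} : ℕ) : ℝ) *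
        ((N : ℝ) + M) * A.card := by
  have hM0 : 0 ≤ M := (abs_nonneg _).trans (hM 1)
  rw [wilsonAction_eq_shadowAction_add_bulkAction ρ (edgeShadow A) V,
    wilsonAction_eq_shadowAction_add_bulkAction ρ (edgeShadow A) W, bulkAction_congr ρ hVW,
    add_sub_add_right_eq_sub]
  have hsh : ∀ U : GaugeConfig d L G, |shadowAction ρ (edgeShadow A) U| ≤
      (((d + 1) * Fintype.card {q : Fin d × Fin d // q.1 < q.2} : ℕ) : ℝ) *
        ((N : ℝ) + M) * A.card := fun U => by
    refine (abs_shadowAction_le ρ hM _ U).trans ?_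
    have h := card_edgeShadow_le A
    have h' : (((edgeShadow A).card * Fintype.card {q : Fin d × Fin d // q.1 < q.2} : ℕ) : ℝ) ≤
        (((d + 1) * Fintype.card {q : Fin d × Fin d // q.1 < q.2} : ℕ) : ℝ) * A.card := by
      have : (edgeShadow A).card * Fintype.card {q : Fin d × Fin d // q.1 < q.2} ≤
          (d + 1) * Fintype.card {q : Fin d × Fin d // q.1 < q.2} * A.card := by
        calc _ ≤ A.card * (d + 1) * Fintype.card {q : Fin d × Fin d // q.1 < q.2} :=
              Nat.mul_le_mul_right _ h
          _ = _ := by ring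
      exact_mod_cast this
    nlinarith [h', show (0 : ℝ) ≤ (N : ℝ) + M by positivity]
  calc |shadowAction ρ (edgeShadow A) V - shadowAction ρ (edgeShadow A) W|
      ≤ |shadowAction ρ (edgeShadow A) V| + |shadowAction ρ (edgeShadow A) W| := abs_sub _ _
    _ ≤ _ := add_le_add (hsh V) (hsh W)
    _ = _ := by ring

/-- A site `x` of the `d`-dimensional torus has at most `2d` incident links: the out-links
`(x, i)` and the in-links `(x - eᵢ, i)`. [folklore] -/
theorem card_filter_incident_le (x : Site d L) :
    (Finset.univ.filter fun ℓ : Edge d L => ℓ.1 = x ∨ ℓ.1.shift ℓ.2 = x).card ≤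
      d + d := by
  classical
  have hsub : (Finset.univ.filter fun ℓ : Edge d L => ℓ.1 = x ∨ ℓ.1.shift ℓ.2 = x) ⊆
      (Finset.univ.image fun i : Fin d => (x, i)) ∪
        (Finset.univ.image fun i : Fin d => (x - Pi.single i 1, i)) := by
    intro ℓ hℓ
    simp only [Finset.mem_filter, Finset.mem_univ, true_and] at hℓ
    simp only [Finset.mem_union, Finset.mem_image, Finset.mem_univ, true_and]
    rcases hℓ with h | h
    · exact Or.inl ⟨ℓ.2, by rw [← h]⟩
    · refine Or.inr ⟨ℓ.2, ?_⟩
      have h' : ℓ.1 = x - Pi.single ℓ.2 1 := eq_sub_of_add_eq h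
      rw [← h']
  calc _ ≤ ((Finset.univ.image fun i : Fin d => (x, i)) ∪
        (Finset.univ.image fun i : Fin d => (x - Pi.single i 1, i))).card :=
        Finset.card_le_card hsub
    _ ≤ (Finset.univ.image fun i : Fin d => (x, i)).card +
        (Finset.univ.image fun i : Fin d => (x - Pi.single i 1, i)).card :=
        Finset.card_union_le _ _
    _ ≤ d + d := add_le_add (Finset.card_image_le.trans (by simp))
        (Finset.card_image_le.trans (by simp))

variable [TopologicalSpace G] [IsTopologicalGroup G] [CompactSpace G] [MeasurableSpace G]
  [BorelSpace G]

/-- **Edgewise two-sided translations** `U ↦ (e ↦ a e · U e · (c e)⁻¹)` of the configuration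
space `G^E` of the torus are measurable equivalences preserving the product Haar probability
measure: link by link a two-sided translation preserves the Haar probability measure of the
compact (unimodular) group (`measurePreserving_mul_mul_inv_haarProbability`), and `Measure.pi`
is preserved factorwise (Mathlib `measurePreserving_pi`). [folklore] -/
theorem exists_measurableEquiv_edgeTranslate (a c : Edge d L → G) :
    ∃ T : GaugeConfig d L G ≃ᵐ GaugeConfig d L G,
      (∀ U, ⇑T U = fun e => a e * U e * (c e)⁻¹) ∧
      MeasurePreserving T (Measure.pi fun _ : Edge d L => haarProbability G)
        (Measure.pi fun _ : Edge d L => haarProbability G) :=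
  ⟨MeasurableEquiv.piCongrRight fun e =>
      (MeasurableEquiv.mulLeft (a e)).trans (MeasurableEquiv.mulRight (c e)⁻¹),
    fun _ => rfl,
    measurePreserving_pi (fun _ : Edge d L => haarProbability G)
      (fun _ : Edge d L => haarProbability G) fun e =>
        measurePreserving_mul_mul_inv_haarProbability (a e) (c e)⟩

/-- **Density bound for the torus Wilson measure.** If a measurable equivalence `T` of `G^E`
preserves the product Haar measure and moves the Wilson action by at most `K`,
`|S_W(T U) - S_W(U)| ≤ K`, then the push-forward of `μ = wilsonMeasure ρ β = Z⁻¹ e^{-β S_W} Haar^{⊗E}`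
under `T` is at most `e^{|β| K} μ`: on a measurable `s`, `μ(T⁻¹ s) = Z⁻¹ ∫_s e^{-β S_W ∘ T⁻¹} dHaar^{⊗E}`
(invariance of `Haar^{⊗E}`) and `e^{-β S_W(T⁻¹ U)} ≤ e^{|β| K} e^{-β S_W(U)}`. No continuity of `ρ`
is needed. [folklore] -/
theorem map_wilsonMeasure_le_smul (ρ : G →* Matrix (Fin N) (Fin N) ℂ) (β K : ℝ)
    (T : GaugeConfig d L G ≃ᵐ GaugeConfig d L G)
    (hT : MeasurePreserving T (Measure.pi fun _ : Edge d L => haarProbability G)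
      (Measure.pi fun _ : Edge d L => haarProbability G))
    (hK : ∀ U, |wilsonAction ρ (T U) - wilsonAction ρ U| ≤ K) :
    (wilsonMeasure (d := d) (L := L) ρ β).map T ≤
      ENNReal.ofReal (Real.exp (|β| * K)) • wilsonMeasure (d := d) (L := L) ρ β := by
  rw [Measure.le_iff]
  intro s hs
  simp only [wilsonMeasure, wilsonWeight, Measure.map_smul, Measure.smul_apply, smul_eq_mul]
  set π : Measure (GaugeConfig d L G) := Measure.pi fun _ : Edge d L => haarProbability G with hπ
  set w : GaugeConfig d L G → ENNReal := fun U =>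
    ENNReal.ofReal (Real.exp (-β * wilsonAction ρ U)) with hw
  have hwle : ∀ U, w (T.symm U) ≤ ENNReal.ofReal (Real.exp (|β| * K)) * w U := by
    intro U
    simp only [hw]
    rw [← ENNReal.ofReal_mul (Real.exp_pos _).le, ← Real.exp_add]
    refine ENNReal.ofReal_le_ofReal (Real.exp_le_exp.2 ?_)
    have h := hK (T.symm U)
    rw [MeasurableEquiv.apply_symm_apply] at h
    have h1 : β * (wilsonAction ρ U - wilsonAction ρ (T.symm U)) ≤ |β| * K := by
      calc β * (wilsonAction ρ U - wilsonAction ρ (T.symm U))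
          ≤ |β * (wilsonAction ρ U - wilsonAction ρ (T.symm U))| := le_abs_self _
        _ = |β| * |wilsonAction ρ U - wilsonAction ρ (T.symm U)| := abs_mul _ _
        _ ≤ |β| * K := mul_le_mul_of_nonneg_left h (abs_nonneg β)
    linarith
  rw [Measure.map_apply T.measurable hs, withDensity_apply _ (T.measurable hs),
    withDensity_apply _ hs]
  have hcv : ∫⁻ U in T ⁻¹' s, w U ∂π = ∫⁻ U in s, w (T.symm U) ∂π := by
    conv_rhs => rw [← hT.map_eq]
    rw [Measure.restrict_map T.measurable hs, lintegral_map_equiv]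
    simp only [MeasurableEquiv.symm_apply_apply]
  rw [hcv]
  calc (partitionFunction ρ β)⁻¹ * ∫⁻ U in s, w (T.symm U) ∂π
      ≤ (partitionFunction ρ β)⁻¹ *
          ∫⁻ U in s, ENNReal.ofReal (Real.exp (|β| * K)) * w U ∂π :=
        mul_le_mul' le_rfl (lintegral_mono fun U => hwle U)
    _ = ENNReal.ofReal (Real.exp (|β| * K)) *
          ((partitionFunction ρ β)⁻¹ * ∫⁻ U in s, w U ∂π) := by
        rw [lintegral_const_mul' _ _ ENNReal.ofReal_ne_top, mul_left_comm]

/-- **Translating finitely many links costs a volume-independent factor**: for `a, c` equal to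
`1` off the finite set `A` of links of the torus, `|Re tr ρ| ≤ M`, and nonnegative `ψ`
integrable against `μ = wilsonMeasure ρ β`,
`∫ ψ(e ↦ a e · U e · (c e)⁻¹) dμ(U) ≤ exp(|β| · 2(d+1) #{planes} (N+M) · |A|) ∫ ψ dμ`
(`exists_measurableEquiv_edgeTranslate`, `abs_wilsonAction_sub_wilsonAction_le`,
`map_wilsonMeasure_le_smul`, `integral_comp_le_of_map_le_smul`). [folklore] -/
theorem integral_comp_edgeTranslate_wilsonMeasure_le (ρ : G →* Matrix (Fin N) (Fin N) ℂ) (β : ℝ)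
    {M : ℝ} (hM : ∀ g, |(ρ g).trace.re| ≤ M) (A : Finset (Edge d L)) (a c : Edge d L → G)
    (ha : ∀ e ∉ A, a e = 1) (hc : ∀ e ∉ A, c e = 1) {ψ : GaugeConfig d L G → ℝ}
    (hψ0 : ∀ U, 0 ≤ ψ U) (hψi : Integrable ψ (wilsonMeasure (d := d) (L := L) ρ β)) :
    ∫ U, ψ (fun e => a e * U e * (c e)⁻¹) ∂(wilsonMeasure (d := d) (L := L) ρ β) ≤
      Real.exp (|β| * (2 * (((d + 1) * Fintype.card {q : Fin d × Fin d // q.1 < q.2} : ℕ) : ℝ) *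
          ((N : ℝ) + M)) * A.card) *
        ∫ U, ψ U ∂(wilsonMeasure (d := d) (L := L) ρ β) := by
  obtain ⟨T, hT, hTπ⟩ := exists_measurableEquiv_edgeTranslate (d := d) (L := L) a c
  have hagree : ∀ (U : GaugeConfig d L G), ∀ e ∉ A, (T U) e = U e := fun U e he => by
    rw [hT]
    simp [ha e he, hc e he]
  have hK : ∀ U, |wilsonAction ρ (T U) - wilsonAction ρ U| ≤
      2 * (((d + 1) * Fintype.card {q : Fin d × Fin d // q.1 < q.2} : ℕ) : ℝ) *
        ((N : ℝ) + M) * A.card :=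
    fun U => abs_wilsonAction_sub_wilsonAction_le ρ hM A (T U) U (hagree U)
  have hle := map_wilsonMeasure_le_smul ρ β _ T hTπ hK
  have h := integral_comp_le_of_map_le_smul (Real.exp_pos _).le T hle hψ0 hψi
  rw [← mul_assoc] at h
  simpa only [hT] using h

end Torus

end Literature.MathematicalPhysics.QuantumLattice

end
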